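import Mathlib.AlgebraicGeometry.AffineScheme
import Mathlib.AlgebraicGeometry.Modules.Sheaf
import Mathlib.Algebra.Category.ModuleCat.Presheaf.EpiMono
import Mathlib.CategoryTheory.Sites.EpiMono
import Mathlib.CategoryTheory.Sites.Abelian
import Mathlib.Topology.Sheaves.LocallySurjective
import Mathlib.Topology.Sheaves.Abelian
import HarnessLib

/-!
# A morphism of `𝒪_X`-modules bijective on the sections over a basis of opens is an isomorphism

For a scheme `X`, a morphism `φ : M → N` of `𝒪_X`-modules and a basis `B` of the topology of `X`
(e.g. the affine opens, `Scheme.isBasis_affineOpens`, or the basic opens inside the members of an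
affine cover):

* `app_injective_of_injective_on_basis` — if `φ_U` is injective for all `U ∈ B`, then `φ_U` is
  injective for EVERY open `U` (a section dying under `φ` dies on the members of `B` below `U`,
  which cover `U`; sheaf locality), hence `φ` is a monomorphism (`mono_of_injective_on_basis`);
* `epi_of_surjective_on_basis` — if `φ_U` is surjective for all `U ∈ B`, then `φ` is locally
  surjective, hence an epimorphism (Mathlib `TopCat.Sheaf.isLocallySurjective_iff_epi`);
* `isIso_of_bijective_on_basis` — both ⇒ `φ` is an isomorphism (`Mod(𝒪_X)` is abelian, hence
  balanced); `isIso_of_bijective_app_of_isAffineOpen` — the case of the affine opens.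

This is the standard reduction of "is an isomorphism" to sections over affine opens (Hartshorne II,
Prop. 1.1 and Ex. 1.2; The Stacks Project, Tag 009U), used by the affine computations of the tree's
coherent formal-module bricks (`Morphisms/FormalFunctionsModule*`). Everything is proved; no named
facts.

## References

* R. Hartshorne, *Algebraic Geometry*, GTM 52 (1977), II Prop. 1.1 and Ex. 1.2 (isomorphism and
  exactness of sheaves are local). [Hartshorne1977]
* The Stacks Project, Tag 009U (sheaves and bases), Tag 00WN (locally surjective maps). [StacksProject]
-/

noncomputable section

open CategoryTheory AlgebraicGeometry TopologicalSpace Opposite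

universe u

namespace Literature.AlgebraicGeometry.Modules

variable {X : Scheme.{u}} {M N : X.Modules} (φ : M ⟶ N) {B : Set X.Opens}

/-- Naturality of `φ_U` in `U`, on elements. [folklore] -/
theorem app_presheaf_map {U V : X.Opens} (i : U ⟶ V) (y : Γ(M, V)) :
    φ.app U (M.presheaf.map i.op y) = N.presheaf.map i.op (φ.app V y) :=
  ConcreteCategory.congr_hom (φ.mapPresheaf.naturality i.op) y

/-- A section of an `𝒪_X`-module vanishing on the members of a basis below `U` vanishes
(sheaf locality along the cover of `U` by the basis opens below it). [cite: StacksProject, Tag 009U] -/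
theorem eq_zero_of_map_eq_zero_on_basis (hB : Opens.IsBasis B) {U : X.Opens} (s : Γ(M, U))
    (h : ∀ V ∈ B, ∀ hVU : V ≤ U, M.presheaf.map (homOfLE hVU).op s = 0) : s = 0 := by
  obtain ⟨Us, hUs, hU⟩ := (Opens.isBasis_iff_cover.mp hB) U
  have hle : ∀ V : Us, (V : X.Opens) ≤ U := fun V => by rw [hU]; exact le_sSup V.2
  have hcover : U ≤ ⨆ V : Us, (V : X.Opens) := by
    rw [hU, sSup_eq_iSup']
  refine TopCat.Sheaf.eq_of_locally_eq' (⟨M.presheaf, M.isSheaf⟩ : TopCat.Sheaf Ab X)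
    (fun V : Us => (V : X.Opens)) U (fun V => homOfLE (hle V)) hcover s 0 fun V => ?_
  change M.presheaf.map (homOfLE (hle V)).op s = M.presheaf.map (homOfLE (hle V)).op 0
  rw [map_zero]
  exact h V (hUs V.2) (hle V)

/-- **Injective on a basis ⇒ injective on every open.** [cite: StacksProject, Tag 009U] -/
theorem app_injective_of_injective_on_basis (hB : Opens.IsBasis B)
    (h : ∀ V ∈ B, Function.Injective (φ.app V)) (U : X.Opens) : Function.Injective (φ.app U) := by
  intro s s' hss'
  rw [← sub_eq_zero]
  refine eq_zero_of_map_eq_zero_on_basis hB _ fun V hV hVU => h V hV ?_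
  rw [map_zero, app_presheaf_map, map_sub, hss', sub_self, map_zero]

/-- **Injective on a basis ⇒ monomorphism.** [cite: StacksProject, Tag 009U] -/
theorem mono_of_injective_on_basis (hB : Opens.IsBasis B)
    (h : ∀ V ∈ B, Function.Injective (φ.app V)) : Mono φ := by
  refine ⟨fun g g' hgg' => Scheme.Modules.hom_ext _ _ fun U => ?_⟩
  ext x
  apply app_injective_of_injective_on_basis φ hB h U
  change (g ≫ φ).app U x = (g' ≫ φ).app U x
  rw [hgg']

/-- **Surjective on a basis ⇒ epimorphism** (locally surjective; Mathlib
`TopCat.Sheaf.isLocallySurjective_iff_epi` for the underlying sheaves of groups).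
[cite: StacksProject, Tag 00WN] -/
theorem epi_of_surjective_on_basis (hB : Opens.IsBasis B)
    (h : ∀ V ∈ B, Function.Surjective (φ.app V)) : Epi φ := by
  have hls : TopCat.Presheaf.IsLocallySurjective φ.mapPresheaf := by
    rw [TopCat.Presheaf.isLocallySurjective_iff]
    intro U t x hx
    obtain ⟨V, hVB, hxV, hVU⟩ := (Opens.isBasis_iff_nbhd.mp hB) hx
    obtain ⟨s, hs⟩ := h V hVB (N.presheaf.map (homOfLE hVU).op t)
    exact ⟨V, hVU, ⟨s, hs⟩, hxV⟩
  have h1 : Epi ((SheafOfModules.toSheaf X.ringCatSheaf).map φ) :=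
    (TopCat.Sheaf.isLocallySurjective_iff_epi _).mp hls
  exact (SheafOfModules.toSheaf X.ringCatSheaf).epi_of_epi_map h1

/-- **Bijective on a basis ⇒ isomorphism** (`Mod(𝒪_X)` is abelian, hence balanced).
[cite: Hartshorne1977, II Prop. 1.1] -/
theorem isIso_of_bijective_on_basis (hB : Opens.IsBasis B)
    (h : ∀ V ∈ B, Function.Bijective (φ.app V)) : IsIso φ :=
  haveI := mono_of_injective_on_basis φ hB fun V hV => (h V hV).1
  haveI := epi_of_surjective_on_basis φ hB fun V hV => (h V hV).2
  isIso_of_mono_of_epi φ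

/-- **Bijective on affine opens ⇒ isomorphism.** [cite: Hartshorne1977, II Prop. 1.1] -/
theorem isIso_of_bijective_app_of_isAffineOpen
    (h : ∀ V : X.Opens, IsAffineOpen V → Function.Bijective (φ.app V)) : IsIso φ :=
  isIso_of_bijective_on_basis φ X.isBasis_affineOpens fun V hV => h V hV

/-- Injective on affine opens ⇒ monomorphism. [cite: StacksProject, Tag 009U] -/
theorem mono_of_injective_app_of_isAffineOpen
    (h : ∀ V : X.Opens, IsAffineOpen V → Function.Injective (φ.app V)) : Mono φ :=
  mono_of_injective_on_basis φ X.isBasis_affineOpens fun V hV => h V hV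

/-- Surjective on affine opens ⇒ epimorphism. [cite: StacksProject, Tag 00WN] -/
theorem epi_of_surjective_app_of_isAffineOpen
    (h : ∀ V : X.Opens, IsAffineOpen V → Function.Surjective (φ.app V)) : Epi φ :=
  epi_of_surjective_on_basis φ X.isBasis_affineOpens fun V hV => h V hV

end Literature.AlgebraicGeometry.Modules

end
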